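import Summits.AtomisticToContinuum.Crystallization.Theorems.FluxTubeKeplerFloorGivesLayered
import Summits.AtomisticToContinuum.Crystallization.Theorems.FluxTubeKeplerFluxCellKeplerSingleScale

/-!
# `RegistryBlindRung` — SPECIAL-CASE file (F3): the family `RegRung κ` specialises to the proved floor

Self-contained, sorry-free copy (namespace `…RegistryLadder.Special`) of the graded family of
`Lines/RegistryBlindRung.lean` (registry ladder over `FluxTubeKepler.FloorGivesLayered`, fwd-rung G1 gen 4, seed
g1-AtomisticToContinuum-15223) with its DECIDED member:
* `regRung_zero : RegRung 0` — the floor `FluxTubeKepler.FloorGivesLayered`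
  (`Theorems.FluxTubeKeplerFloorGivesLayered.FloorGivesLayered_proof`) followed by the proved `PeriodicGivenLayered`;
  the only rewriting is `layeredGood_of_regGood_zero` (a zero lateral perturbation is no perturbation).
Also the dial monotonicity `regRung_anti` (harder-to-easier = decreasing `κ`).  The deciding rung
`RegistryBlindRung := RegRung 1` is the member NOT decided here.  No `sorry`.
-/

noncomputable section

namespace Summit.AtomisticToContinuum.Crystallization.Cruxes.FluxCellKepler.RegistryLadder.Special

open scoped BigOperators Classical
open Filter Topology
open Literature.MathematicalPhysics.StatisticalMechanics
open Summit.AtomisticToContinuum.Crystallization.Theorems.FluxCellKeplerSingleScale (LayeredGood)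

local notation "E3" => EuclideanSpace ℝ (Fin 3)

/-- FLOOR(P₀): `N · e(P₀) ≤ E(x)` for every Lennard-Jones ground state (verbatim the floor's first hypothesis). -/
def Floor (P₀ : PeriodicConfiguration 3) : Prop :=
  ∀ (N : ℕ) (x : Fin N → E3), IsGroundState lennardJones x →
    (N : ℝ) * P₀.energyPerParticle lennardJones ≤ interactionEnergy lennardJones x

/-- `κ`-LAMINAR-GOOD SITE: some admissible layered template (spacing `a ∈ [47/50, 1]`, Hägg word `s`, heights in
the box, rigid motion `A`) whose layer `m` is moreover translated laterally by `(o m).1 • u + (o m).2 • v` with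
`|(o m).1|, |(o m).2| ≤ κ`, matches the `R`-ball around `x i` two-way with tolerance `η`.  `κ = 0`: the floor's
Barlow-registered predicate `LayeredGood R η`; `κ = 1`: every registry (registry-blind). -/
def RegGood (κ R η : ℝ) {N : ℕ} (x : Fin N → E3) (i : Fin N) : Prop :=
  ∃ a : ℝ, 47 / 50 ≤ a ∧ a ≤ 1 ∧ ∃ (A : E3 →ₗᵢ[ℝ] E3) (s : ℤ → ℤ) (z : ℤ → ℝ) (o : ℤ → ℝ × ℝ), IsHaggSeq s ∧
    (∀ m : ℤ, 39 / 50 * a ≤ z (m + 1) - z m ∧ z (m + 1) - z m ≤ 17 / 20 * a) ∧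
    (∀ m : ℤ, |(o m).1| ≤ κ ∧ |(o m).2| ≤ κ) ∧
    let S : Set E3 := {p | ∃ m k l : ℤ, p = A (((k : ℝ) • triangularVec₁ a) + ((l : ℝ) • triangularVec₂ a) +
      ((haggLabel s m : ℝ) • barlowOffset a) + (((o m).1 • triangularVec₁ a) + ((o m).2 • triangularVec₂ a)) +
      (z m • layerNormal 1))}
    (∀ p ∈ S, ‖p‖ ≤ R → ∃ j : Fin N, dist (x j - x i) p ≤ η) ∧
    (∀ j : Fin N, ‖x j - x i‖ ≤ R → ∃ p ∈ S, dist (x j - x i) p ≤ η)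

/-- REGISTRY-BLIND BUDGET with dial `κ`: at every scale `(R,η)` some `c > 0` prices the sites that are not
`κ`-laminar-good against the excess energy over `N · e(P₀)` (`κ = 0`: the floor's budget). -/
def RegBudget (κ : ℝ) (P₀ : PeriodicConfiguration 3) : Prop :=
  ∀ R η : ℝ, 0 < R → 0 < η → ∃ c : ℝ, 0 < c ∧
    ∀ (N : ℕ) (x : Fin N → E3), IsGroundState lennardJones x →
      c * (Nat.card {i : Fin N // ¬ RegGood κ R η x i} : ℝ) ≤
        interactionEnergy lennardJones x - (N : ℝ) * P₀.energyPerParticle lennardJones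

/-- Periodic windows at every scale along `x` (verbatim the conclusion of `FluxTubeKepler.PeriodicGivenLayered`). -/
def HasPeriodicWindows (x : (N : ℕ) → (Fin N → E3)) : Prop :=
  ∃ P : PeriodicConfiguration 3, ∀ R ε : ℝ, 0 < ε → ∃ᶠ N in atTop, ∃ t : E3,
    (∀ s ∈ P.points, ‖s‖ ≤ R → ∃ i : Fin N, dist (x N i + t) s ≤ ε) ∧
    (∀ i : Fin N, ‖x N i + t‖ ≤ R → ∃ s ∈ P.points, dist (x N i + t) s ≤ ε)

/-- **The graded family.** `RegRung κ`: FLOOR and the `κ`-registry-blind budget force periodic windows along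
every Lennard-Jones ground-state sequence. -/
def RegRung (κ : ℝ) : Prop :=
  ∀ P₀ : PeriodicConfiguration 3, Floor P₀ → RegBudget κ P₀ →
    ∀ x : (N : ℕ) → (Fin N → E3), (∀ N, IsGroundState lennardJones (x N)) → HasPeriodicWindows x

/-- **Deciding rung.** The budget need not price STACKING REGISTRY at all: pricing only the sites whose
`R`-neighbourhood is not `η`-close to SOME stack of triangular layers (any lateral position of each layer, heights
in the box) suffices — the Barlow registry of the windows is then selected by the energy. -/
def RegistryBlindRung : Prop := RegRung 1

/-! ## Bookkeeping and the decided member -/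

theorem regGood_mono {κ κ' R η : ℝ} (hκ : κ ≤ κ') {N : ℕ} (x : Fin N → E3) (i : Fin N) :
    RegGood κ R η x i → RegGood κ' R η x i := by
  rintro ⟨a, ha₁, ha₂, A, s, z, o, hs, hz, ho, h₁, h₂⟩
  exact ⟨a, ha₁, ha₂, A, s, z, o, hs, hz, fun m => ⟨(ho m).1.trans hκ, (ho m).2.trans hκ⟩, h₁, h₂⟩

theorem layeredGood_of_regGood_zero {R η : ℝ} {N : ℕ} (x : Fin N → E3) (i : Fin N) :
    RegGood 0 R η x i → LayeredGood R η x i := by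
  rintro ⟨a, ha₁, ha₂, A, s, z, o, hs, hz, ho, h₁, h₂⟩
  have ho' : ∀ m : ℤ, (o m).1 = 0 ∧ (o m).2 = 0 := fun m =>
    ⟨abs_nonpos_iff.mp (ho m).1, abs_nonpos_iff.mp (ho m).2⟩
  refine ⟨a, ha₁, ha₂, A, s, z, hs, hz, ?_, ?_⟩
  · rintro p ⟨m, k, l, rfl⟩ hpR
    exact h₁ _ ⟨m, k, l, by simp [(ho' m).1, (ho' m).2]⟩ hpR
  · intro j hj
    obtain ⟨p, ⟨m, k, l, rfl⟩, hjp⟩ := h₂ j hj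
    exact ⟨_, ⟨m, k, l, rfl⟩, by simpa [(ho' m).1, (ho' m).2] using hjp⟩

theorem regGood_zero_of_layeredGood {R η : ℝ} {N : ℕ} (x : Fin N → E3) (i : Fin N) :
    LayeredGood R η x i → RegGood 0 R η x i := by
  rintro ⟨a, ha₁, ha₂, A, s, z, hs, hz, h₁, h₂⟩
  refine ⟨a, ha₁, ha₂, A, s, z, fun _ => ((0 : ℝ), (0 : ℝ)), hs, hz, fun m => ⟨by simp, by simp⟩, ?_, ?_⟩
  · rintro p ⟨m, k, l, rfl⟩ hpR
    exact h₁ _ ⟨m, k, l, by simp⟩ (by simpa using hpR)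
  · intro j hj
    obtain ⟨p, ⟨m, k, l, rfl⟩, hjp⟩ := h₂ j hj
    exact ⟨_, ⟨m, k, l, rfl⟩, by simpa using hjp⟩

/-- The budget is monotone in the dial: a budget pricing the larger bad set prices the smaller one. -/
theorem regBudget_mono {κ κ' : ℝ} (hκ : κ ≤ κ') (P₀ : PeriodicConfiguration 3) :
    RegBudget κ P₀ → RegBudget κ' P₀ := by
  intro hB R η hR hη
  obtain ⟨c, hc, hcB⟩ := hB R η hR hη
  refine ⟨c, hc, fun N x hx => le_trans ?_ (hcB N x hx)⟩
  have hle : Nat.card {i : Fin N // ¬ RegGood κ' R η x i} ≤ Nat.card {i : Fin N // ¬ RegGood κ R η x i} := by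
    rw [Nat.card_eq_fintype_card, Nat.card_eq_fintype_card]
    exact Fintype.card_subtype_mono _ _ fun i hi hg => hi (regGood_mono hκ x i hg)
  exact mul_le_mul_of_nonneg_left (by exact_mod_cast hle) hc.le

/-! ## F3 — the family specialises to the proved floor -/

/-- `RegRung 0` is the floor: the seed theorem followed by the proved `PeriodicGivenLayered`. -/
theorem regRung_zero : RegRung 0 := by
  intro P₀ hF hB x hx
  refine Theses.FluxTubeKepler.PeriodicGivenLayered_holds x hx
    (Theorems.FluxTubeKeplerFloorGivesLayered.FloorGivesLayered_proof P₀ hF ?_ x hx)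
  intro R η hR hη
  obtain ⟨c, hc, hcB⟩ := hB R η hR hη
  refine ⟨c, hc, fun N y hy => ?_⟩
  show c * (Nat.card {i : Fin N // ¬ LayeredGood R η y i} : ℝ) ≤ _
  refine le_trans ?_ (hcB N y hy)
  have hle : Nat.card {i : Fin N // ¬ LayeredGood R η y i} ≤ Nat.card {i : Fin N // ¬ RegGood 0 R η y i} := by
    rw [Nat.card_eq_fintype_card, Nat.card_eq_fintype_card]
    exact Fintype.card_subtype_mono _ _ fun i hi hg => hi (layeredGood_of_regGood_zero y i hg)
  exact mul_le_mul_of_nonneg_left (by exact_mod_cast hle) hc.le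

/-! ## Dial monotonicity (harder-to-easier = decreasing `κ`) -/

theorem regRung_anti {κ κ' : ℝ} (hκ : κ ≤ κ') : RegRung κ' → RegRung κ :=
  fun H P₀ hF hB x hx => H P₀ hF (regBudget_mono hκ P₀ hB) x hx

/-- The deciding rung gives every member below it, in particular the floor (informational `specialises`). -/
theorem regRung_of_registryBlindRung {κ : ℝ} (hκ : κ ≤ 1) (h : RegistryBlindRung) : RegRung κ :=
  regRung_anti hκ h

end Summit.AtomisticToContinuum.Crystallization.Cruxes.FluxCellKepler.RegistryLadder.Special

end
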